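import Literature.Analysis.FluidPDE.GCLMViscousSelfSimilarAnsatz
import HarnessLib

/-!
# SHEET-ℝ origin law: `(1 − a)·HΩ(0) = 3/2 − ν·Ω‴(0)/Ω′(0)` for a profile with a simple zero at the origin

HONEST FRAMING (cell ns-blowup GROUP B / zone Z3, case Z3-SR-CERT; 1-D MODEL (viscous gCLM self-similar profile on the line); not Euler/NS).

The steady dynamic-rescaling equation of the viscous gCLM at the parabolic scaling, `ViscousGCLMProfileEqAt a ν Ω X` of
`Literature/Analysis/FluidPDE/GCLMViscousSelfSimilarAnsatz.lean` (`(X/2 + a·U(X))·Ω′(X) = (−1 + HΩ(X))·Ω(X) + ν·Ω″(X)`, `U = ∫₀ˣ HΩ`), read at a simple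
zero of an odd profile at the origin, gives — exactly as the OSW E2 origin identity `(1 − a)·Hf(0) = 1` does on the circle
(`OSWAprioriAnalyticStep.origin_identity`, `OSWAprioriWindow.origin_identity_of_simple_zero`) — the ORIGIN LAW

  `(1 − a)·HΩ(0) = 3/2 − ν·Ω‴(0)/Ω′(0)`

(divide by `Ω(X) = X·(Ω(X)/X)` and let `X → 0⁺`: `X Ω′/Ω → 1`, `U(X)/X → HΩ(0)`, `Ω″(X)/X → Ω‴(0)`). It is a pure-limits statement (`origin_law` below,
for the general transport coefficient `cl·X`: `cl + a·H₀ = −1 + H₀ + ν·Ω‴(0)/Ω′(0)`), typed here against the tree's predicate (`origin_law_viscousGCLM`)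
so that the Z3-SR-CERT certificate of the point `(a, c_l, ε) = (0.2, ½, 1)` (profile-lead RULING (ay); cert-1 SHEET-R-PRICE-impl1.md §2 (C5) quotes this
law) has a kernel consistency check for its enclosures of `HΩ*(0)`, `Ω*′(0)`, `Ω*‴(0)`. MODEL statement; no definition, no named fact; nothing about
existence of a profile.
-/

noncomputable section

namespace Summit.NavierStokesRegularity.OSWSelfSimilar
namespace SheetROriginLaw

open _root_.Set _root_.Filter Literature.Analysis.FluidPDE
open scoped Real Topology

/-- **ORIGIN LAW (pure limits).** If on some `(0, δ)` the profile equation `(cl·x + a·g(x))·f′(x) = (−1 + h(x))·f(x) + ν·f″(x)` holds with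
`f ≠ 0`, and as `x → 0⁺`: `f(x)/x → κ ≠ 0` (simple zero), `f′(x) → κ`, `f″(x)/x → κ₃` (`f″(0) = 0`, `f‴(0) = κ₃`), `g(x)/x → H₀` (`g(0) = 0`,
`g′(0) = H₀`) and `h(x) → H₀` (`h = Hf` continuous at `0`), then `cl + a·H₀ = −1 + H₀ + ν·κ₃/κ`. [folklore] -/
theorem origin_law {a ν cl κ κ₃ H₀ δ : ℝ} {f f' f'' g h : ℝ → ℝ} (hδ : 0 < δ)
    (hEq : ∀ x ∈ Ioo 0 δ, (cl * x + a * g x) * f' x = (-1 + h x) * f x + ν * f'' x)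
    (hf0 : ∀ x ∈ Ioo 0 δ, f x ≠ 0)
    (hslope : Tendsto (fun x => f x / x) (𝓝[>] 0) (𝓝 κ)) (hκ : κ ≠ 0)
    (hf' : Tendsto f' (𝓝[>] 0) (𝓝 κ)) (hf'' : Tendsto (fun x => f'' x / x) (𝓝[>] 0) (𝓝 κ₃))
    (hg : Tendsto (fun x => g x / x) (𝓝[>] 0) (𝓝 H₀)) (hh : Tendsto h (𝓝[>] 0) (𝓝 H₀)) :
    cl + a * H₀ = -1 + H₀ + ν * κ₃ / κ := by
  -- left side, normalised by `f(x)/x`:  (cl + a g/x)·(f′/(f/x)) → (cl + a H₀)·(κ/κ)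
  have hL : Tendsto (fun x => (cl + a * (g x / x)) * (f' x / (f x / x))) (𝓝[>] 0)
      (𝓝 ((cl + a * H₀) * (κ / κ))) :=
    (tendsto_const_nhds.add (hg.const_mul a)).mul (hf'.div hslope hκ)
  -- right side: −1 + h + ν (f″/x)/(f/x) → −1 + H₀ + ν κ₃/κ
  have hR : Tendsto (fun x => -1 + h x + ν * ((f'' x / x) / (f x / x))) (𝓝[>] 0)
      (𝓝 (-1 + H₀ + ν * (κ₃ / κ))) :=
    (tendsto_const_nhds.add hh).add ((hf''.div hslope hκ).const_mul ν)
  -- the two normalised sides agree on `(0, δ)`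
  have heq : ∀ᶠ x in 𝓝[>] (0 : ℝ),
      (cl + a * (g x / x)) * (f' x / (f x / x)) = -1 + h x + ν * ((f'' x / x) / (f x / x)) := by
    filter_upwards [Ioo_mem_nhdsGT hδ] with x hx
    have hx0 : x ≠ 0 := ne_of_gt hx.1
    have hfx : f x ≠ 0 := hf0 x hx
    have e := hEq x hx
    rw [div_div_div_cancel_right₀ hx0, div_div_eq_mul_div]
    rw [show (cl + a * (g x / x)) * (f' x * x / f x) = ((cl * x + a * g x) * f' x) / f x by
      field_simp]
    rw [e]
    field_simp
  have := tendsto_nhds_unique (hL.congr' heq) hR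
  rw [div_self hκ, mul_one] at this
  linear_combination this

/-- **ORIGIN LAW for the typed SHEET-ℝ equation.** If `ViscousGCLMProfileEqAt a ν Ω X` holds for `X ∈ (0, δ)` with `Ω ≠ 0` there, and at the origin
`Ω(X)/X → κ ≠ 0`, `Ω′(X) → κ`, `Ω″(X)/X → κ₃` (odd `C³` profile: `κ = Ω′(0)`, `κ₃ = Ω‴(0)`), `U(X)/X → H₀` and `HΩ(X) → H₀` (`H₀ = HΩ(0)`;
`U = lineVelocity Ω`, `H = lineHilbert`), then `(1 − a)·H₀ = 3/2 − ν·κ₃/κ`. At `ν = 0` this is the inviscid origin law `(1 − a)·HΩ(0) = 3/2` of the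
`(c_ω, c_l) = (−1, ½)` gauge. [folklore] -/
theorem origin_law_viscousGCLM {a ν κ κ₃ H₀ δ : ℝ} {Ω : ℝ → ℝ} (hδ : 0 < δ)
    (hP : ∀ X ∈ Ioo 0 δ, ViscousGCLMProfileEqAt a ν Ω X) (hΩ0 : ∀ X ∈ Ioo 0 δ, Ω X ≠ 0)
    (hslope : Tendsto (fun X => Ω X / X) (𝓝[>] 0) (𝓝 κ)) (hκ : κ ≠ 0)
    (hd1 : Tendsto (deriv Ω) (𝓝[>] 0) (𝓝 κ)) (hd2 : Tendsto (fun X => iteratedDeriv 2 Ω X / X) (𝓝[>] 0) (𝓝 κ₃))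
    (hU : Tendsto (fun X => lineVelocity Ω X / X) (𝓝[>] 0) (𝓝 H₀)) (hH : Tendsto (lineHilbert Ω) (𝓝[>] 0) (𝓝 H₀)) :
    (1 - a) * H₀ = 3 / 2 - ν * κ₃ / κ := by
  have h := origin_law (cl := 1 / 2) (f := Ω) (f' := deriv Ω) (f'' := fun X => iteratedDeriv 2 Ω X) (g := lineVelocity Ω)
    (h := lineHilbert Ω) hδ (fun X hX => (viscousGCLMProfileEqAt_iff a ν Ω X).mp (hP X hX)) hΩ0 hslope hκ hd1 hd2 hU hH
  linear_combination (-1 : ℝ) * h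

/-- The inviscid case `ν = 0` (`GCLMProfileEqAt a (1/2) (−1)`, cf. `viscousGCLMProfileEqAt_zero_iff`): `(1 − a)·HΩ(0) = 3/2` at a simple zero —
no third-derivative datum needed. [folklore] -/
theorem origin_law_inviscid {a κ H₀ δ : ℝ} {Ω : ℝ → ℝ} (hδ : 0 < δ)
    (hP : ∀ X ∈ Ioo 0 δ, GCLMProfileEqAt a (1 / 2) (-1) Ω X) (hΩ0 : ∀ X ∈ Ioo 0 δ, Ω X ≠ 0)
    (hslope : Tendsto (fun X => Ω X / X) (𝓝[>] 0) (𝓝 κ)) (hκ : κ ≠ 0)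
    (hd1 : Tendsto (deriv Ω) (𝓝[>] 0) (𝓝 κ))
    (hU : Tendsto (fun X => lineVelocity Ω X / X) (𝓝[>] 0) (𝓝 H₀)) (hH : Tendsto (lineHilbert Ω) (𝓝[>] 0) (𝓝 H₀)) :
    (1 - a) * H₀ = 3 / 2 := by
  have hEq : ∀ X ∈ Ioo 0 δ, (1 / 2 * X + a * lineVelocity Ω X) * deriv Ω X
      = (-1 + lineHilbert Ω X) * Ω X + 0 * (fun _ : ℝ => (0 : ℝ)) X := by
    intro X hX
    have h := (viscousGCLMProfileEqAt_iff a 0 Ω X).mp ((viscousGCLMProfileEqAt_zero_iff a Ω X).mpr (hP X hX))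
    simp only [zero_mul, add_zero] at h ⊢
    exact h
  have h0 : Tendsto (fun X : ℝ => (fun _ : ℝ => (0 : ℝ)) X / X) (𝓝[>] 0) (𝓝 0) := by
    simp only [zero_div]
    exact tendsto_const_nhds
  have h := origin_law (cl := 1 / 2) (ν := 0) (f := Ω) (f' := deriv Ω) (f'' := fun _ : ℝ => (0 : ℝ)) (g := lineVelocity Ω)
    (h := lineHilbert Ω) hδ hEq hΩ0 hslope hκ hd1 h0 hU hH
  linear_combination (-1 : ℝ) * h

end SheetROriginLaw
end Summit.NavierStokesRegularity.OSWSelfSimilar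

end
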